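import Summits.QuantumFields.YangMills.Theorems.ColdStartUniversalityLatticeLangevinAutocorrelationTime
import Summits.QuantumFields.YangMills.Theorems.ColdStartUniversalityLatticeLangevinSupport
import Summits.QuantumFields.YangMills.Theorems.ColdStartUniversalityLatticeLangevinInvariantOfKernel
import HarnessLib

/-!
# Route `ColdStartUniversality` (fixed-cut-off SZZ dynamics, sampler package): THE GREEN–KUBO VARIANCE IS NON-DEGENERATE —
# `σ²(G) > 0` for every continuous NON-CONSTANT observable (reversibility + full support of `μ_(β')`)

Helper file (seat `ym-line-csu-p1`, g35; `--supports stmt-QuantumFields-24809`).  The studentised CLT (file 95b), the asymptotic coverage of the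
batch-means confidence intervals (file 97) and the sharp Bernstein rate (file 96b) are informative exactly when the asymptotic variance
`σ²(G) = 2∫₀^∞⟨Ĝ, κ_tĜ⟩_μ dt` is POSITIVE.  For the reversible SU(2) SZZ dynamics this is automatic for every non-trivial observable:
* `wilsonMeasure_pos_of_isOpen` — `μ_(β')(O) > 0` for every non-empty open `O` (invariance + irreducibility of the kernels, file `…Support`);
* `integral_sq_centred_pos_of_ne` — a continuous `G` taking two different values has `Var_μ(G) = ∫ (G − μG)² dμ > 0`;
* ★★ `greenKubo_pos_of_variance_pos` — `Var_μ(G) > 0 ⇒ ∫₀^∞⟨Ĝ,κ_tĜ⟩_μ dt > 0` (the autocorrelation function `t ↦ ⟨Ĝ,κ_tĜ⟩ = ‖κ_(t/2)Ĝ‖²` is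
  non-negative by reversibility, continuous, and equals `Var_μ(G) > 0` at `t = 0`);
* ★★★ `greenKubo_pos_of_ne` — hence `σ²(G) > 0` for EVERY continuous `G` that is not constant, at every coupling and volume.
THEOREMS ONLY, no definition, no sorry; [folklore] (Kipnis–Varadhan: `σ² = 2⟨Ĝ,(−𝓛)⁻¹Ĝ⟩ > 0` for reversible ergodic processes).  HONEST FRAMING:
fixed cut-off; no lower bound uniform in `L` or in the cut-off is claimed; `UniformColdStartMixing` (24809) is NOT restated; no crux, rung or summit
statement is proved; the Yang–Mills mass gap is NOT proved.
-/

set_option autoImplicit false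

noncomputable section

namespace Summit.QuantumFields.YangMills.Theorems.ColdStartUniversality

open MeasureTheory ProbabilityTheory Filter Topology Set
open scoped NNReal ENNReal BigOperators
open Literature Literature.Probability.Process Literature.MathematicalPhysics.QuantumFieldTheory
open Literature.MathematicalPhysics.QuantumLattice (fundamentalRep fundamentalLatticeRep continuous_fundamentalRep)

variable {L : ℕ} [NeZero L]

/-- **Full support of the Wilson–Gibbs measure**: `μ_(β')(O) > 0` for every non-empty open set `O` of configurations
(invariance `μ = μκ_1` and irreducibility `κ_1(x, O) > 0` for all `x`). [folklore] -/
theorem wilsonMeasure_pos_of_isOpen (L : ℕ) [NeZero L] (β' : ℝ)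
    {O : Set (GaugeConfig 3 L (Matrix.specialUnitaryGroup (Fin 2) ℂ))} (hO : IsOpen O) (hne : O.Nonempty) :
    0 < wilsonMeasure (d := 3) (L := L) (fundamentalRep (Fin 2)) β' O := by
  classical
  haveI := secondCountableTopology_su2
  haveI := borelSpace_config L
  haveI : IsProbabilityMeasure (wilsonMeasure (d := 3) (L := L) (fundamentalRep (Fin 2)) β') :=
    isProbabilityMeasure_wilsonMeasure (d := 3) (L := L) (fundamentalRep (Fin 2)) (continuous_fundamentalRep (Fin 2)) β'
  obtain ⟨κ, hκ, -, hreal⟩ := exists_transitionKernel L β'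
  haveI := hκ
  have hinv : Kernel.Invariant (κ 1) (wilsonMeasure (d := 3) (L := L) (fundamentalRep (Fin 2)) β') :=
    wilson_invariant_of_fact L β' (wilsonMeasureLangevinInvariant_su2 L β') κ hreal 1
  have hpos : ∀ x, 0 < κ 1 x O := fun x =>
    transition_apply_pos_of_isOpen (L := L) β' κ hreal (t := 1) (by norm_num) x hO hne
  have hb : (wilsonMeasure (d := 3) (L := L) (fundamentalRep (Fin 2)) β').bind (κ 1) =
      wilsonMeasure (d := 3) (L := L) (fundamentalRep (Fin 2)) β' := hinv.def
  have hO' : wilsonMeasure (d := 3) (L := L) (fundamentalRep (Fin 2)) β' O =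
      ((wilsonMeasure (d := 3) (L := L) (fundamentalRep (Fin 2)) β').bind (κ 1)) O := by rw [hb]
  rw [hO', Measure.bind_apply hO.measurableSet (κ 1).aemeasurable]
  refine pos_iff_ne_zero.2 fun h0 => ?_
  rw [lintegral_eq_zero_iff ((κ 1).measurable_coe hO.measurableSet)] at h0
  have h1 : ∀ᵐ x ∂(wilsonMeasure (d := 3) (L := L) (fundamentalRep (Fin 2)) β'), κ 1 x O = 0 :=
    h0.mono fun x hx => by simpa using hx
  have h2 := ae_iff.1 h1
  have huniv : {x | ¬κ 1 x O = 0} = (Set.univ : Set (GaugeConfig 3 L (Matrix.specialUnitaryGroup (Fin 2) ℂ))) :=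
    Set.eq_univ_of_forall fun x => (hpos x).ne'
  rw [huniv, measure_univ] at h2
  exact one_ne_zero h2

/-- **A continuous observable taking two different values has positive variance under `μ_(β')`.** [folklore] -/
theorem integral_sq_centred_pos_of_ne (L : ℕ) [NeZero L] (β' : ℝ)
    {G : GaugeConfig 3 L (Matrix.specialUnitaryGroup (Fin 2) ℂ) → ℝ} (hGc : Continuous G) {CG : ℝ} (hGb : ∀ z, |G z| ≤ CG)
    {y₁ y₂ : GaugeConfig 3 L (Matrix.specialUnitaryGroup (Fin 2) ℂ)} (hne : G y₁ ≠ G y₂) :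
    0 < ∫ y, (G y - ∫ z, G z ∂(wilsonMeasure (d := 3) (L := L) (fundamentalRep (Fin 2)) β')) ^ 2
      ∂(wilsonMeasure (d := 3) (L := L) (fundamentalRep (Fin 2)) β') := by
  classical
  haveI := secondCountableTopology_su2
  haveI := borelSpace_config L
  set μ : Measure (GaugeConfig 3 L (Matrix.specialUnitaryGroup (Fin 2) ℂ)) :=
    wilsonMeasure (d := 3) (L := L) (fundamentalRep (Fin 2)) β' with hμ
  haveI : IsProbabilityMeasure μ :=
    isProbabilityMeasure_wilsonMeasure (d := 3) (L := L) (fundamentalRep (Fin 2)) (continuous_fundamentalRep (Fin 2)) β'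
  set m : ℝ := ∫ z, G z ∂μ with hm
  set Gh : GaugeConfig 3 L (Matrix.specialUnitaryGroup (Fin 2) ℂ) → ℝ := fun z => G z - m with hGh
  have hGhc : Continuous Gh := hGc.sub continuous_const
  -- some point where `Ĝ ≠ 0`
  obtain ⟨y₀, hy₀⟩ : ∃ y₀, Gh y₀ ≠ 0 := by
    by_contra h
    push Not at h
    have h1 : G y₁ = m := by have := h y₁; simp only [hGh] at this; linarith
    have h2 : G y₂ = m := by have := h y₂; simp only [hGh] at this; linarith
    exact hne (h1.trans h2.symm)
  set a : ℝ := |Gh y₀| / 2 with ha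
  have ha0 : 0 < a := by positivity
  set O : Set (GaugeConfig 3 L (Matrix.specialUnitaryGroup (Fin 2) ℂ)) := {y | a < |Gh y|} with hO
  have hOo : IsOpen O := isOpen_lt continuous_const (continuous_abs.comp hGhc)
  have hOne : O.Nonempty := ⟨y₀, by simp only [hO, ha, Set.mem_setOf_eq]; linarith [abs_pos.2 hy₀]⟩
  have hμO : 0 < μ O := wilsonMeasure_pos_of_isOpen L β' hOo hOne
  have hμOr : 0 < μ.real O := ENNReal.toReal_pos hμO.ne' (measure_ne_top _ _)
  -- `∫ Ĝ² ≥ a² μ(O)`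
  have hGh2i : Integrable (fun y => Gh y ^ 2) μ := by
    refine (integrable_const ((CG + |m|) ^ 2)).mono' (hGhc.measurable.pow_const 2).aestronglyMeasurable
      (Eventually.of_forall fun y => ?_)
    rw [Real.norm_eq_abs, abs_of_nonneg (sq_nonneg _), ← sq_abs]
    have h1 : |Gh y| ≤ CG + |m| := (abs_sub _ _).trans (add_le_add (hGb y) le_rfl)
    exact pow_le_pow_left₀ (abs_nonneg _) h1 2
  have hind : ∀ y, a ^ 2 * O.indicator (fun _ => (1 : ℝ)) y ≤ Gh y ^ 2 := fun y => by
    by_cases hy : y ∈ O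
    · rw [Set.indicator_of_mem hy, mul_one]
      have hy' : a < |Gh y| := by simpa [hO] using hy
      calc a ^ 2 ≤ |Gh y| ^ 2 := pow_le_pow_left₀ ha0.le hy'.le 2
        _ = Gh y ^ 2 := sq_abs _
    · rw [Set.indicator_of_notMem hy, mul_zero]; exact sq_nonneg _
  have hlow : a ^ 2 * μ.real O ≤ ∫ y, Gh y ^ 2 ∂μ := by
    have h1 : ∫ y, a ^ 2 * O.indicator (fun _ => (1 : ℝ)) y ∂μ = a ^ 2 * μ.real O := by
      rw [integral_const_mul]
      congr 1
      exact integral_indicator_one hOo.measurableSet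
    rw [← h1]
    exact integral_mono ((integrable_const _).indicator hOo.measurableSet |>.const_mul _) hGh2i hind
  exact lt_of_lt_of_le (by positivity) hlow

/-- ★★ **Positive variance ⇒ positive Green–Kubo constant** (reversibility: `⟨Ĝ, κ_tĜ⟩_μ = ‖κ_(t/2)Ĝ‖² ≥ 0`, continuity at `t = 0`):
for every realising kernel family and continuous `G` with `∫ Ĝ² dμ_(β') > 0`, `0 < ∫₀^∞ ∫ Ĝ·κ_tĜ dμ_(β') dt`. [folklore] -/
theorem greenKubo_pos_of_variance_pos (L : ℕ) [NeZero L] (β' : ℝ)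
    (κ : ℝ≥0 → Kernel (GaugeConfig 3 L (Matrix.specialUnitaryGroup (Fin 2) ℂ))
      (GaugeConfig 3 L (Matrix.specialUnitaryGroup (Fin 2) ℂ))) [∀ t, IsMarkovKernel (κ t)]
    (hreal : ∀ (t : ℝ≥0) (x : GaugeConfig 3 L (Matrix.specialUnitaryGroup (Fin 2) ℂ))
        (Ω : Type) [MeasurableSpace Ω] (P : Measure Ω) [IsProbabilityMeasure P]
        (W : ℝ≥0 → Ω → (Edge 3 L × NoiseIdx 2 → ℝ)) (hW : IsFlatBrownian W P)
        (U : ℝ≥0 → Ω → GaugeConfig 3 L (Matrix.specialUnitaryGroup (Fin 2) ℂ)),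
        (∀ ω, U 0 ω = x) →
        (latticeLangevinDynamics (fundamentalLatticeRep 2) β').IsSolution (fundamentalRep (Fin 2))
          hW.natFiltration P W U →
        κ t x = P.map (U t))
    {G : GaugeConfig 3 L (Matrix.specialUnitaryGroup (Fin 2) ℂ) → ℝ} (hGc : Continuous G) {CG : ℝ} (hGb : ∀ z, |G z| ≤ CG)
    (hvar : 0 < ∫ y, (G y - ∫ z, G z ∂(wilsonMeasure (d := 3) (L := L) (fundamentalRep (Fin 2)) β')) ^ 2
      ∂(wilsonMeasure (d := 3) (L := L) (fundamentalRep (Fin 2)) β')) :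
    0 < ∫ t in Ioi (0 : ℝ), (∫ y, (G y - ∫ z, G z ∂(wilsonMeasure (d := 3) (L := L) (fundamentalRep (Fin 2)) β')) *
        (∫ z, (G z - ∫ z', G z' ∂(wilsonMeasure (d := 3) (L := L) (fundamentalRep (Fin 2)) β')) ∂(κ t.toNNReal y))
        ∂(wilsonMeasure (d := 3) (L := L) (fundamentalRep (Fin 2)) β')) := by
  classical
  haveI := secondCountableTopology_su2
  haveI := borelSpace_config L
  set μ : Measure (GaugeConfig 3 L (Matrix.specialUnitaryGroup (Fin 2) ℂ)) :=
    wilsonMeasure (d := 3) (L := L) (fundamentalRep (Fin 2)) β' with hμ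
  haveI : IsProbabilityMeasure μ :=
    isProbabilityMeasure_wilsonMeasure (d := 3) (L := L) (fundamentalRep (Fin 2)) (continuous_fundamentalRep (Fin 2)) β'
  set m : ℝ := ∫ z, G z ∂μ with hm
  set Gh : GaugeConfig 3 L (Matrix.specialUnitaryGroup (Fin 2) ℂ) → ℝ := fun z => G z - m with hGh
  have hGhc : Continuous Gh := hGc.sub continuous_const
  have hGi : Integrable G μ := (integrable_const CG).mono' hGc.measurable.aestronglyMeasurable
    (Eventually.of_forall fun z => by rw [Real.norm_eq_abs]; exact hGb z)
  have hGh0 : ∫ z, Gh z ∂μ = 0 := by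
    simp only [hGh]; rw [integral_sub hGi (integrable_const m), integral_const, smul_eq_mul, probReal_univ, one_mul, hm]; exact sub_self _
  obtain ⟨c, hc, hAT⟩ := integral_autocorrelation_le L β'
  obtain ⟨hφi, -, -⟩ := hAT κ hreal Gh hGhc hGh0
  set φ : ℝ → ℝ := fun t => ∫ x, Gh x * (∫ y, Gh y ∂(κ t.toNNReal x)) ∂μ with hφ
  -- continuity, non-negativity, value at 0
  have hJ : Continuous (Function.uncurry fun (t : ℝ) (x : GaugeConfig 3 L (Matrix.specialUnitaryGroup (Fin 2) ℂ)) =>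
      Gh x * ∫ y, Gh y ∂(κ t.toNNReal x)) :=
    (hGhc.comp continuous_snd).mul ((continuous_transitionKernel_action β' κ hreal hGhc).comp
      ((continuous_real_toNNReal.comp continuous_fst).prodMk continuous_snd))
  have hφc : Continuous φ := continuous_integral_of_continuous_uncurry μ hJ
  have hφnn : ∀ t, 0 ≤ φ t := fun t => integral_mul_transition_self_nonneg L β' κ hreal t.toNNReal hGhc
  have hκ0 : κ 0 = Kernel.id := transitionKernel_zero_eq_id (L := L) β' κ hreal
  have hφ0 : φ 0 = ∫ y, Gh y ^ 2 ∂μ := by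
    simp only [hφ, Real.toNNReal_zero, hκ0, Kernel.id_apply]
    exact integral_congr_ae (ae_of_all _ fun x => by
      show Gh x * ∫ y, Gh y ∂(Measure.dirac x) = Gh x ^ 2
      rw [integral_dirac' _ _ hGhc.measurable.stronglyMeasurable]; ring)
  have hφ0pos : 0 < φ 0 := by rw [hφ0]; exact hvar
  -- continuity at `0`: `φ > φ(0)/2` on `[0, δ]`
  have hnhds : ∀ᶠ t in 𝓝 (0 : ℝ), φ 0 / 2 < φ t :=
    (hφc.tendsto 0).eventually (Ioi_mem_nhds (by linarith))
  obtain ⟨δ, hδ, hball⟩ := Metric.eventually_nhds_iff.1 hnhds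
  have hδ2 : 0 < δ / 2 := by linarith
  -- `∫_(Ioi 0) φ ≥ ∫_(Ioc 0 (δ/2)) φ ≥ (δ/2)·φ(0)/2`
  have hsub : Ioc (0 : ℝ) (δ / 2) ⊆ Ioi 0 := fun t ht => ht.1
  have h1 : ∫ t in Ioc (0 : ℝ) (δ / 2), φ t ≤ ∫ t in Ioi (0 : ℝ), φ t :=
    setIntegral_mono_set hφi (Eventually.of_forall fun t => hφnn t) (Eventually.of_forall hsub)
  have h2 : (δ / 2) * (φ 0 / 2) ≤ ∫ t in Ioc (0 : ℝ) (δ / 2), φ t := by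
    have h3 : ∫ t in Ioc (0 : ℝ) (δ / 2), φ 0 / 2 ≤ ∫ t in Ioc (0 : ℝ) (δ / 2), φ t := by
      refine setIntegral_mono_on (integrableOn_const (hs := measure_Ioc_lt_top.ne)) (hφi.mono_set hsub) measurableSet_Ioc fun t ht => ?_
      exact (hball (by rw [dist_zero_right, Real.norm_eq_abs, abs_of_pos ht.1]; linarith [ht.2])).le
    rw [setIntegral_const, smul_eq_mul, Real.volume_real_Ioc_of_le hδ2.le, sub_zero] at h3
    exact h3
  exact lt_of_lt_of_le (lt_of_lt_of_le (by positivity) h2) h1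

/-- ★★★ **The Green–Kubo variance of every non-constant continuous observable is positive**: for every realising kernel family and every
continuous bounded `G` taking two different values, `0 < 2∫₀^∞ ∫ Ĝ·κ_tĜ dμ_(β') dt = σ²(G)` — the hypothesis of the studentised CLT and of the
confidence-interval coverage theorem holds for every non-trivial observable (e.g. every non-constant Wilson loop functional). [folklore] -/
theorem greenKubo_pos_of_ne (L : ℕ) [NeZero L] (β' : ℝ)
    (κ : ℝ≥0 → Kernel (GaugeConfig 3 L (Matrix.specialUnitaryGroup (Fin 2) ℂ))
      (GaugeConfig 3 L (Matrix.specialUnitaryGroup (Fin 2) ℂ))) [∀ t, IsMarkovKernel (κ t)]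
    (hreal : ∀ (t : ℝ≥0) (x : GaugeConfig 3 L (Matrix.specialUnitaryGroup (Fin 2) ℂ))
        (Ω : Type) [MeasurableSpace Ω] (P : Measure Ω) [IsProbabilityMeasure P]
        (W : ℝ≥0 → Ω → (Edge 3 L × NoiseIdx 2 → ℝ)) (hW : IsFlatBrownian W P)
        (U : ℝ≥0 → Ω → GaugeConfig 3 L (Matrix.specialUnitaryGroup (Fin 2) ℂ)),
        (∀ ω, U 0 ω = x) →
        (latticeLangevinDynamics (fundamentalLatticeRep 2) β').IsSolution (fundamentalRep (Fin 2))
          hW.natFiltration P W U →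
        κ t x = P.map (U t))
    {G : GaugeConfig 3 L (Matrix.specialUnitaryGroup (Fin 2) ℂ) → ℝ} (hGc : Continuous G) {CG : ℝ} (hGb : ∀ z, |G z| ≤ CG)
    {y₁ y₂ : GaugeConfig 3 L (Matrix.specialUnitaryGroup (Fin 2) ℂ)} (hne : G y₁ ≠ G y₂) :
    0 < 2 * ∫ t in Ioi (0 : ℝ), (∫ y, (G y - ∫ z, G z ∂(wilsonMeasure (d := 3) (L := L) (fundamentalRep (Fin 2)) β')) *
        (∫ z, (G z - ∫ z', G z' ∂(wilsonMeasure (d := 3) (L := L) (fundamentalRep (Fin 2)) β')) ∂(κ t.toNNReal y))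
        ∂(wilsonMeasure (d := 3) (L := L) (fundamentalRep (Fin 2)) β')) :=
  mul_pos two_pos (greenKubo_pos_of_variance_pos L β' κ hreal hGc hGb (integral_sq_centred_pos_of_ne L β' hGc hGb hne))

end Summit.QuantumFields.YangMills.Theorems.ColdStartUniversality

end
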